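import Literature.AlgebraicGeometry.Deformation.SmoothSchemeLiftObstructionCechCocycleIdentity
import Literature.AlgebraicGeometry.Morphisms.CechModuleH2
import HarnessLib

/-!
# The Čech obstruction 2-cochain under conjugation by chart automorphisms; intertwined lifts on one cover
# (Hartshorne, *Deformation Theory*, proof of Thm. 10.2 (a): independence of the trivialisations — the same-cover half)

Layer `Literature/AlgebraicGeometry/Deformation`, namespace `Literature.AlgebraicGeometry.Deformation` (THEOREMS only: no
definition, no instance, no notation, no named fact).  Sequel of ★ F2 `SmoothSchemeLiftObstructionCechCocycle` /
`…CechCocycleIdentity` in the SAME currency (`k`, `X/Spec k` with `halg`, a principal affine cover `U, b, hb`, `A' ⊇ J, 𝔫'`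
with `J² = 0`, `J𝔫' = 0`, `𝔫'` nilpotent, `e : J ≅ k`; lifted transition automorphisms `ψ j l` of `A' ⊗_k Γ(U j ∩ U l)`,
`≡ 1 (mod 𝔫')`; the REPRESENTATION clause «`u (1 ⊗ c) = 1 ⊗ c + t ⊗ θ(dc)`» and F2's characterisation `ho` of an obstruction
cochain `o ∈ Č²(𝔘, 𝒯_{X/k})`).

THE PRINT. [Hartshorne2010, Thm. 10.2 (a), proof, p. 81] chooses trivialisations `U'_i ≅ U_i × Spec C'` of the charts and
lifts `φ'_{ij}` of the transition maps; the obstruction `δ₃` «is independent of all choices»: changing the trivialisation of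
the chart `U'_i` by an automorphism `F_i` (inducing the identity on the closed fibre) CONJUGATES the transition data,
`φ_{ij} ↦ F_j| φ_{ij} F_i|⁻¹`, and two systems of lifted data describing ISOMORPHIC deformations over `C = C'/J` are, after such
a conjugation, two lifts of the same datum — so their cochains differ by a coboundary (★ F2-B §6).  This file:

* §1 ring level: automorphisms `≡ 1` modulo an ideal are closed under products and inverses; **an automorphism `≡ 1 (mod J)`
  is CENTRALISED by every automorphism `≡ 1 (mod 𝔫')`** (`conj_eq_of_sub_mem`: `G D G⁻¹ = D`; ★ A3a `infinitesimalAut_mul_comm`).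
* §2 **CONJUGATION INVARIANCE `obstructionCochain_conj`**: if `o` satisfies F2's characterisation for `ψ`, it satisfies it
  for the conjugated system `ψ^F j l := F_l| ψ j l F_j|⁻¹` (`F_j|, F_l|` the restrictions to `U j ∩ U l` of chart automorphisms
  `F j` of `A' ⊗_k Γ(U j)`, `≡ 1 (mod 𝔫')`): on a triple overlap the conjugated discrepancy is `G_m D G_m⁻¹ = D`.
* §3 **SAME COVER, INTERTWINED LIFTS `exists_cechMD1_eq_sub_of_conj`**: two systems `ψ₁, ψ₂` on ONE principal affine cover
  with chart automorphisms `F j ≡ 1 (mod 𝔫')` such that `F_l| ∘ ψ₁ j l ≡ ψ₂ j l ∘ F_j| (mod J)` (the shape of the functoriality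
  hypothesis `hFψ` at `f := 𝟙`) have obstruction cochains with `o₂ − o₁ = d¹α` for some `α ∈ Č¹(𝔘, 𝒯_{X/k})`
  (`ψ₂ (ψ₁^F)⁻¹ ≡ 1 (mod J)` is represented by `α`; ★ F2-B `obstructionCochain_sub_eq_cechMD1`), hence `o₂ − o₁ ∈ B̌²`.

Cell `hodgecm-mathlib`, F-11 road (a′), slot (4) rel₂ (COVER INDEPENDENCE of the obstruction class): with
`SmoothSchemeLiftObstructionRefine{,Cochain}` (restriction along a basic-open refinement) this is the same-cover half.
HC_CM is proved only modulo the 7 printed citations until rung 0 closes — nothing here bears on a summit statement.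

## References
* [Hartshorne2010] R. Hartshorne, *Deformation Theory*, GTM 257, Springer (2010): Thm. 10.2 (a) and its proof (p. 81),
  Remark 10.1.1 (p. 80), Cor. 10.3 (p. 82).
* [Hartshorne1977] R. Hartshorne, *Algebraic Geometry*, GTM 52 (1977): III §4 p. 218 (Čech cochains on an affine cover).
-/

noncomputable section

-- `TopCat.Presheaf`/`TopCat.Sheaf` are not reducible (as in Mathlib's `AlgebraicGeometry/Modules`).
set_option backward.isDefEq.respectTransparency false

open CategoryTheory AlgebraicGeometry Opposite TopologicalSpace
open scoped TensorProduct

universe u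

namespace Literature.AlgebraicGeometry.Deformation

open Literature.AlgebraicGeometry.HodgeTheory Literature.AlgebraicGeometry.Modules
  Literature.AlgebraicGeometry.Motives Literature.AlgebraicGeometry.Morphisms SmoothAffineDeformation

variable {k : Type u} [Field k] {X : Over (Spec (CommRingCat.of k))}
  [instΓ : ∀ W : X.left.Opens, Algebra k Γ(X.left, W)]
  (halg : ∀ (W : X.left.Opens) (s : k), algebraMap k Γ(X.left, W) s = (constToPresheaf X).app (op W) s)
  {A' : Type u} [CommRing A'] [Algebra k A']

/-! ## §1 Ring level: congruences modulo an ideal; centrality of the infinitesimal automorphisms -/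

section Ring

variable {R : Type*} [CommRing R] [Algebra A' R] (I : Ideal A')

omit instΓ in
/-- Products of automorphisms `≡ 1 (mod I)` are `≡ 1 (mod I)`. [cite: Hartshorne2010, Remark 10.1.1, p. 80] -/
theorem mul_apply_sub_self_mem_smul_top {u v : R ≃ₐ[A'] R} (hu : ∀ x, u x - x ∈ I • (⊤ : Submodule A' R))
    (hv : ∀ x, v x - x ∈ I • (⊤ : Submodule A' R)) (x : R) : (u * v) x - x ∈ I • (⊤ : Submodule A' R) := by
  have e1 : (u * v) x - x = (u (v x) - v x) + (v x - x) := by rw [AlgEquiv.mul_apply]; abel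
  rw [e1]
  exact Submodule.add_mem _ (hu _) (hv _)

omit instΓ in
/-- Inverses of automorphisms `≡ 1 (mod I)` are `≡ 1 (mod I)`. [cite: Hartshorne2010, Remark 10.1.1, p. 80] -/
theorem inv_apply_sub_self_mem_smul_top {u : R ≃ₐ[A'] R} (hu : ∀ x, u x - x ∈ I • (⊤ : Submodule A' R)) (x : R) :
    u⁻¹ x - x ∈ I • (⊤ : Submodule A' R) := by
  have h := hu (u⁻¹ x)
  rw [AlgEquiv.aut_inv, AlgEquiv.apply_symm_apply] at h
  rw [AlgEquiv.aut_inv, ← neg_sub]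
  exact Submodule.neg_mem _ h

variable (J 𝔫' : Ideal A') (hJ : J * J = ⊥) (hJ𝔫 : J * 𝔫' = ⊥) {B₀ : Type u} [CommRing B₀] [Algebra k B₀]

omit instΓ in
include hJ hJ𝔫 in
/-- **Centrality: an automorphism `D ≡ 1 (mod J)` of `A' ⊗_k B₀` is centralised by every automorphism `G ≡ 1 (mod 𝔫')`**
(`G D G⁻¹ = D`; `D = θ_δ` is infinitesimal, ★ `exists_eq_infinitesimalAut_iff`, and `θ_δ G = G θ_δ` by `J𝔫' = 0`,
★ `infinitesimalAut_mul_comm`). [cite: Hartshorne2010, Remark 10.1.1, p. 80] [cite: Hartshorne2010, Thm. 10.2 (proof), p. 81] -/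
theorem conj_eq_of_sub_mem {D G : A' ⊗[k] B₀ ≃ₐ[A'] A' ⊗[k] B₀}
    (hD : ∀ x, D x - x ∈ J • (⊤ : Submodule A' (A' ⊗[k] B₀)))
    (hG : ∀ x, G x - x ∈ 𝔫' • (⊤ : Submodule A' (A' ⊗[k] B₀))) : G * D * G⁻¹ = D := by
  obtain ⟨δ, hδ⟩ := (exists_eq_infinitesimalAut_iff J hJ D).2 hD
  have hcomm : D * G = G * D := by rw [← hδ]; exact infinitesimalAut_mul_comm J hJ hJ𝔫 G hG δ
  rw [← hcomm, mul_inv_cancel_right]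

omit instΓ in
/-- A congruence on the `1 ⊗ c` extends `A'`-linearly: if `f (1 ⊗ c) − g (1 ⊗ c) ∈ I·(A' ⊗ B')` for two `A'`-linear maps,
then `f x − g x ∈ I·(A' ⊗ B')` for all `x`. [cite: Hartshorne2010, Remark 10.1.1, p. 80] -/
theorem sub_mem_smul_top_of_forall_one_tmul {B B' : Type*} [CommRing B] [Algebra k B] [AddCommGroup B'] [Module A' B']
    (f g : A' ⊗[k] B →ₗ[A'] B') (h : ∀ c : B, f ((1 : A') ⊗ₜ c) - g ((1 : A') ⊗ₜ c) ∈ I • (⊤ : Submodule A' B'))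
    (x : A' ⊗[k] B) : f x - g x ∈ I • (⊤ : Submodule A' B') := by
  induction x using TensorProduct.induction_on with
  | zero => rw [map_zero, map_zero, sub_zero]; exact Submodule.zero_mem _
  | tmul a c =>
    have hac : (a ⊗ₜ[k] c : A' ⊗[k] B) = a • ((1 : A') ⊗ₜ[k] c) := by
      rw [TensorProduct.smul_tmul', smul_eq_mul, mul_one]
    rw [hac, map_smul, map_smul, ← smul_sub]
    exact Submodule.smul_mem _ a (h c)
  | add x y hx hy =>
    have e1 : f (x + y) - g (x + y) = (f x - g x) + (f y - g y) := by rw [map_add, map_add]; abel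
    rw [e1]
    exact Submodule.add_mem _ hx hy

end Ring

/-! ## §2 Conjugation invariance of the obstruction cochain -/

section Conj

variable {ι : Type u} (U : ι → X.left.affineOpens) (b : (j l : ι) → Γ(X.left, (U j).1))
  (hb : ∀ j l, (U j).1 ⊓ (U l).1 = X.left.basicOpen (b j l))
  (J 𝔫' : Ideal A') (hJ : J * J = ⊥) (hJ𝔫 : J * 𝔫' = ⊥) (e : ↥(J.restrictScalars k) ≃ₗ[k] k)

include halg hb hJ hJ𝔫 in
/-- **CONJUGATION INVARIANCE OF THE OBSTRUCTION COCHAIN.** Let `F j` be `A'`-automorphisms of the charts `A' ⊗_k Γ(U j)`,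
`≡ 1 (mod 𝔫')`, with restrictions `FR j l = F j|_{U j ∩ U l}`, `FL j l = F l|_{U j ∩ U l}` (characterised through the base
changes, `≡ 1 (mod 𝔫')`).  If `o ∈ Č²(𝔘, 𝒯_{X/k})` satisfies F2's characterisation for `ψ` (it represents the triple
discrepancies of the restrictions of the `ψ`'s), then it satisfies it for the CONJUGATED system `FL j l ψ j l (FR j l)⁻¹`:
on `U j ∩ U l ∩ U m`, with `G` the restrictions of the `F`'s (both routes from a chart agree, ★ F2-B
`compat_of_restrict_of_restrict`), the restrictions of the conjugated system are the `G`-conjugates of restrictions of `ψ`, and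
their discrepancy is `G_m D G_m⁻¹ = D` (§1). [cite: Hartshorne2010, Thm. 10.2 (proof), p. 81] [cite: Hartshorne2010, Remark 10.1.1, p. 80] -/
theorem obstructionCochain_conj (h𝔫 : IsNilpotent 𝔫')
    (ψ : (j l : ι) → A' ⊗[k] Γ(X.left, (U j).1 ⊓ (U l).1) ≃ₐ[A'] A' ⊗[k] Γ(X.left, (U j).1 ⊓ (U l).1))
    (F : (j : ι) → A' ⊗[k] Γ(X.left, (U j).1) ≃ₐ[A'] A' ⊗[k] Γ(X.left, (U j).1))
    (FR FL : (j l : ι) → A' ⊗[k] Γ(X.left, (U j).1 ⊓ (U l).1) ≃ₐ[A'] A' ⊗[k] Γ(X.left, (U j).1 ⊓ (U l).1))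
    (hFR : ∀ (j l : ι) (Φ : A' ⊗[k] Γ(X.left, (U j).1) →ₐ[A'] A' ⊗[k] Γ(X.left, (U j).1 ⊓ (U l).1)),
      (∀ a x, Φ (a ⊗ₜ x) = a ⊗ₜ X.left.presheaf.map (homOfLE inf_le_left).op x) → ∀ x, FR j l (Φ x) = Φ (F j x))
    (hFL : ∀ (j l : ι) (Φ : A' ⊗[k] Γ(X.left, (U l).1) →ₐ[A'] A' ⊗[k] Γ(X.left, (U j).1 ⊓ (U l).1)),
      (∀ a x, Φ (a ⊗ₜ x) = a ⊗ₜ X.left.presheaf.map (homOfLE inf_le_right).op x) → ∀ x, FL j l (Φ x) = Φ (F l x))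
    (hFR𝔫 : ∀ j l y, FR j l y - y ∈ 𝔫' • (⊤ : Submodule A' (A' ⊗[k] Γ(X.left, (U j).1 ⊓ (U l).1))))
    (hFL𝔫 : ∀ j l y, FL j l y - y ∈ 𝔫' • (⊤ : Submodule A' (A' ⊗[k] Γ(X.left, (U j).1 ⊓ (U l).1))))
    (o : CechMC2 X.hom (tangentSheaf X) (fun j => (U j).1))
    (ho : ∀ (j l m : ι)
      (Φjl : A' ⊗[k] Γ(X.left, (U j).1 ⊓ (U l).1) →ₐ[A'] A' ⊗[k] Γ(X.left, (U j).1 ⊓ (U l).1 ⊓ (U m).1))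
      (_ : ∀ a s, Φjl (a ⊗ₜ s) = a ⊗ₜ X.left.presheaf.map (homOfLE inf_le_left).op s)
      (Φlm : A' ⊗[k] Γ(X.left, (U l).1 ⊓ (U m).1) →ₐ[A'] A' ⊗[k] Γ(X.left, (U j).1 ⊓ (U l).1 ⊓ (U m).1))
      (_ : ∀ a s, Φlm (a ⊗ₜ s) = a ⊗ₜ X.left.presheaf.map
        (homOfLE (le_inf (inf_le_left.trans inf_le_right) inf_le_right)).op s)
      (Φjm : A' ⊗[k] Γ(X.left, (U j).1 ⊓ (U m).1) →ₐ[A'] A' ⊗[k] Γ(X.left, (U j).1 ⊓ (U l).1 ⊓ (U m).1))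
      (_ : ∀ a s, Φjm (a ⊗ₜ s) = a ⊗ₜ X.left.presheaf.map
        (homOfLE (le_inf (inf_le_left.trans inf_le_left) inf_le_right)).op s)
      (ρjl ρlm ρjm : A' ⊗[k] Γ(X.left, (U j).1 ⊓ (U l).1 ⊓ (U m).1) ≃ₐ[A']
        A' ⊗[k] Γ(X.left, (U j).1 ⊓ (U l).1 ⊓ (U m).1)),
      (∀ x, ρjl (Φjl x) = Φjl (ψ j l x)) → (∀ x, ρlm (Φlm x) = Φlm (ψ l m x)) →
      (∀ x, ρjm (Φjm x) = Φjm (ψ j m x)) →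
      ∀ c : Γ(X.left, (U j).1 ⊓ (U l).1 ⊓ (U m).1), (ρlm * ρjl * ρjm⁻¹) ((1 : A') ⊗ₜ c) =
        (1 : A') ⊗ₜ c + ((e.symm 1 : ↥(J.restrictScalars k)) : A') ⊗ₜ
          (show Γ(X.left, (U j).1 ⊓ (U l).1 ⊓ (U m).1) from appLE (o j l m) (𝟙 _) (dSection X _ c)))
    (j l m : ι)
    (Φjl : A' ⊗[k] Γ(X.left, (U j).1 ⊓ (U l).1) →ₐ[A'] A' ⊗[k] Γ(X.left, (U j).1 ⊓ (U l).1 ⊓ (U m).1))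
    (hΦjl : ∀ a s, Φjl (a ⊗ₜ s) = a ⊗ₜ X.left.presheaf.map (homOfLE inf_le_left).op s)
    (Φlm : A' ⊗[k] Γ(X.left, (U l).1 ⊓ (U m).1) →ₐ[A'] A' ⊗[k] Γ(X.left, (U j).1 ⊓ (U l).1 ⊓ (U m).1))
    (hΦlm : ∀ a s, Φlm (a ⊗ₜ s) = a ⊗ₜ X.left.presheaf.map
      (homOfLE (le_inf (inf_le_left.trans inf_le_right) inf_le_right)).op s)
    (Φjm : A' ⊗[k] Γ(X.left, (U j).1 ⊓ (U m).1) →ₐ[A'] A' ⊗[k] Γ(X.left, (U j).1 ⊓ (U l).1 ⊓ (U m).1))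
    (hΦjm : ∀ a s, Φjm (a ⊗ₜ s) = a ⊗ₜ X.left.presheaf.map
      (homOfLE (le_inf (inf_le_left.trans inf_le_left) inf_le_right)).op s)
    (ρ'jl ρ'lm ρ'jm : A' ⊗[k] Γ(X.left, (U j).1 ⊓ (U l).1 ⊓ (U m).1) ≃ₐ[A']
      A' ⊗[k] Γ(X.left, (U j).1 ⊓ (U l).1 ⊓ (U m).1))
    (hρ'jl : ∀ x, ρ'jl (Φjl x) = Φjl ((FL j l * ψ j l * (FR j l)⁻¹) x))
    (hρ'lm : ∀ x, ρ'lm (Φlm x) = Φlm ((FL l m * ψ l m * (FR l m)⁻¹) x))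
    (hρ'jm : ∀ x, ρ'jm (Φjm x) = Φjm ((FL j m * ψ j m * (FR j m)⁻¹) x))
    (c : Γ(X.left, (U j).1 ⊓ (U l).1 ⊓ (U m).1)) :
    (ρ'lm * ρ'jl * ρ'jm⁻¹) ((1 : A') ⊗ₜ c) =
      (1 : A') ⊗ₜ c + ((e.symm 1 : ↥(J.restrictScalars k)) : A') ⊗ₜ
        (show Γ(X.left, (U j).1 ⊓ (U l).1 ⊓ (U m).1) from appLE (o j l m) (𝟙 _) (dSection X _ c)) := by
  -- the triple overlap is principal in the three pairwise overlaps (★ F2 §4) and in the three charts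
  have hW₃jl : (U j).1 ⊓ (U l).1 ⊓ (U m).1 =
      X.left.basicOpen (X.left.presheaf.map (homOfLE (inf_le_left : (U j).1 ⊓ (U l).1 ≤ (U j).1)).op (b j m)) :=
    inf_eq_basicOpen_map U b hb inf_le_left m
  have hW₃lm : (U j).1 ⊓ (U l).1 ⊓ (U m).1 =
      X.left.basicOpen (X.left.presheaf.map (homOfLE (inf_le_left : (U l).1 ⊓ (U m).1 ≤ (U l).1)).op (b l j)) := by
    rw [← inf_eq_basicOpen_map U b hb inf_le_left j]
    ac_rfl
  have hW₃jm : (U j).1 ⊓ (U l).1 ⊓ (U m).1 =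
      X.left.basicOpen (X.left.presheaf.map (homOfLE (inf_le_left : (U j).1 ⊓ (U m).1 ≤ (U j).1)).op (b j l)) := by
    rw [← inf_eq_basicOpen_map U b hb inf_le_left l]
    ac_rfl
  have hW₃j : (U j).1 ⊓ (U l).1 ⊓ (U m).1 = X.left.basicOpen
      (X.left.presheaf.map (homOfLE (le_refl (U j).1)).op (b j l) *
        X.left.presheaf.map (homOfLE (le_refl (U j).1)).op (b j m)) := by
    rw [← inf_inf_eq_basicOpen_map U b hb (le_refl (U j).1) l m]
  have hW₃l : (U j).1 ⊓ (U l).1 ⊓ (U m).1 = X.left.basicOpen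
      (X.left.presheaf.map (homOfLE (le_refl (U l).1)).op (b l j) *
        X.left.presheaf.map (homOfLE (le_refl (U l).1)).op (b l m)) := by
    rw [← inf_inf_eq_basicOpen_map U b hb (le_refl (U l).1) j m]
    ac_rfl
  have hW₃m : (U j).1 ⊓ (U l).1 ⊓ (U m).1 = X.left.basicOpen
      (X.left.presheaf.map (homOfLE (le_refl (U m).1)).op (b m l) *
        X.left.presheaf.map (homOfLE (le_refl (U m).1)).op (b m j)) := by
    rw [← inf_inf_eq_basicOpen_map U b hb (le_refl (U m).1) l j]
    ac_rfl
  -- base changes from the charts to the pairwise overlaps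
  obtain ⟨Φj_jl, hΦj_jl⟩ := exists_baseChangeMap (A' := A') halg (U j).1 ((U j).1 ⊓ (U l).1) inf_le_left
  obtain ⟨Φl_jl, hΦl_jl⟩ := exists_baseChangeMap (A' := A') halg (U l).1 ((U j).1 ⊓ (U l).1) inf_le_right
  obtain ⟨Φl_lm, hΦl_lm⟩ := exists_baseChangeMap (A' := A') halg (U l).1 ((U l).1 ⊓ (U m).1) inf_le_left
  obtain ⟨Φm_lm, hΦm_lm⟩ := exists_baseChangeMap (A' := A') halg (U m).1 ((U l).1 ⊓ (U m).1) inf_le_right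
  obtain ⟨Φj_jm, hΦj_jm⟩ := exists_baseChangeMap (A' := A') halg (U j).1 ((U j).1 ⊓ (U m).1) inf_le_left
  obtain ⟨Φm_jm, hΦm_jm⟩ := exists_baseChangeMap (A' := A') halg (U m).1 ((U j).1 ⊓ (U m).1) inf_le_right
  -- the restrictions `G` of the chart automorphisms to the triple overlap (first route) …
  obtain ⟨Gj, hGj, hGj𝔫⟩ := exists_algEquiv_restrict halg 𝔫' (isAffineOpen_inf₂ U b hb j l) _ hW₃jl inf_le_left h𝔫
    (FR j l) (hFR𝔫 j l) hΦjl
  obtain ⟨Gl, hGl, -⟩ := exists_algEquiv_restrict halg 𝔫' (isAffineOpen_inf₂ U b hb j l) _ hW₃jl inf_le_left h𝔫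
    (FL j l) (hFL𝔫 j l) hΦjl
  obtain ⟨Gm, hGm, hGm𝔫⟩ := exists_algEquiv_restrict halg 𝔫' (isAffineOpen_inf₂ U b hb l m) _ hW₃lm
    (le_inf (inf_le_left.trans inf_le_right) inf_le_right) h𝔫 (FL l m) (hFL𝔫 l m) hΦlm
  -- … also restrict along the second route (★ F2-B `compat_of_restrict_of_restrict`)
  have hGj' : ∀ y, Gj (Φjm y) = Φjm (FR j m y) :=
    compat_of_restrict_of_restrict halg 𝔫' (U j).2 _ hW₃j inf_le_left inf_le_left inf_le_left
      (le_inf (inf_le_left.trans inf_le_left) inf_le_right) (isAffineOpen_inf₂ U b hb j m) _ hW₃jm h𝔫 (F j)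
      hΦj_jl hΦj_jm hΦjl hΦjm (hFR j l Φj_jl hΦj_jl) (hFR j m Φj_jm hΦj_jm) (hFR𝔫 j m) hGj
  have hGl' : ∀ y, Gl (Φlm y) = Φlm (FR l m y) :=
    compat_of_restrict_of_restrict halg 𝔫' (U l).2 _ hW₃l inf_le_right inf_le_left inf_le_left
      (le_inf (inf_le_left.trans inf_le_right) inf_le_right) (isAffineOpen_inf₂ U b hb l m) _ hW₃lm h𝔫 (F l)
      hΦl_jl hΦl_lm hΦjl hΦlm (hFL j l Φl_jl hΦl_jl) (hFR l m Φl_lm hΦl_lm) (hFR𝔫 l m) hGl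
  have hGm' : ∀ y, Gm (Φjm y) = Φjm (FL j m y) :=
    compat_of_restrict_of_restrict halg 𝔫' (U m).2 _ hW₃m inf_le_right inf_le_right
      (le_inf (inf_le_left.trans inf_le_right) inf_le_right) (le_inf (inf_le_left.trans inf_le_left) inf_le_right)
      (isAffineOpen_inf₂ U b hb j m) _ hW₃jm h𝔫 (F m)
      hΦm_lm hΦm_jm hΦlm hΦjm (hFL l m Φm_lm hΦm_lm) (hFL j m Φm_jm hΦm_jm) (hFL𝔫 j m) hGm
  -- the un-conjugated restrictions `G⁻¹ ρ' G` restrict the `ψ`'s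
  have hρjl : ∀ x, (Gl⁻¹ * ρ'jl * Gj) (Φjl x) = Φjl (ψ j l x) := fun x => by
    rw [AlgEquiv.mul_apply, AlgEquiv.mul_apply, hGj, hρ'jl, AlgEquiv.mul_apply, AlgEquiv.mul_apply,
      AlgEquiv.aut_inv, AlgEquiv.aut_inv, AlgEquiv.symm_apply_apply, ← hGl, AlgEquiv.symm_apply_apply]
  have hρlm : ∀ x, (Gm⁻¹ * ρ'lm * Gl) (Φlm x) = Φlm (ψ l m x) := fun x => by
    rw [AlgEquiv.mul_apply, AlgEquiv.mul_apply, hGl', hρ'lm, AlgEquiv.mul_apply, AlgEquiv.mul_apply,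
      AlgEquiv.aut_inv, AlgEquiv.aut_inv, AlgEquiv.symm_apply_apply, ← hGm, AlgEquiv.symm_apply_apply]
  have hρjm : ∀ x, (Gm⁻¹ * ρ'jm * Gj) (Φjm x) = Φjm (ψ j m x) := fun x => by
    rw [AlgEquiv.mul_apply, AlgEquiv.mul_apply, hGj', hρ'jm, AlgEquiv.mul_apply, AlgEquiv.mul_apply,
      AlgEquiv.aut_inv, AlgEquiv.aut_inv, AlgEquiv.symm_apply_apply, ← hGm', AlgEquiv.symm_apply_apply]
  -- `o j l m` represents their discrepancy `D`, and the conjugated discrepancy is `G_m D G_m⁻¹ = D`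
  have hθ := ho j l m Φjl hΦjl Φlm hΦlm Φjm hΦjm (Gl⁻¹ * ρ'jl * Gj) (Gm⁻¹ * ρ'lm * Gl) (Gm⁻¹ * ρ'jm * Gj)
    hρjl hρlm hρjm
  have hgrp : ρ'lm * ρ'jl * ρ'jm⁻¹ =
      Gm * ((Gm⁻¹ * ρ'lm * Gl) * (Gl⁻¹ * ρ'jl * Gj) * (Gm⁻¹ * ρ'jm * Gj)⁻¹) * Gm⁻¹ := by
    group
  rw [hgrp, conj_eq_of_sub_mem J 𝔫' hJ hJ𝔫 (sub_mem_of_rep J e hθ) hGm𝔫]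
  exact hθ c

end Conj

/-! ## §3 Intertwined lift systems on one cover have cohomologous obstruction cochains -/

section SameCover

variable {ι : Type u} (U : ι → X.left.affineOpens) (b : (j l : ι) → Γ(X.left, (U j).1))
  (hb : ∀ j l, (U j).1 ⊓ (U l).1 = X.left.basicOpen (b j l))
  (J 𝔫' : Ideal A') (hJ : J * J = ⊥) (hJ𝔫 : J * 𝔫' = ⊥) (e : ↥(J.restrictScalars k) ≃ₗ[k] k)

include halg hb hJ hJ𝔫 in
/-- **INTERTWINED LIFTS ON ONE COVER: `o₂ − o₁ = d¹α`.** Two systems `ψ₁, ψ₂` of lifted transition automorphisms on the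
principal affine cover `𝔘` (both `≡ 1 (mod 𝔫')`), chart automorphisms `F j` of `A' ⊗_k Γ(U j)`, `≡ 1 (mod 𝔫')`, which
INTERTWINE them modulo `J` — `F_l| (ψ₁ j l (1 ⊗ c)) − ψ₂ j l (F_j| (1 ⊗ c)) ∈ J·(A' ⊗ Γ(U j ∩ U l))` for all characterised
restrictions `F_j|, F_l|` (the two glued deformations are isomorphic over `A'/J`) — and obstruction cochains `o₁` of `ψ₁`,
`o₂` of `ψ₂` (F2's characterisation): then `o₂ − o₁ = d¹α` for some `α ∈ Č¹(𝔘, 𝒯_{X/k})` (`α j l` represents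
`ψ₂ j l (F_l| ψ₁ j l F_j|⁻¹)⁻¹ ≡ 1 (mod J)`; `o₁` is an obstruction cochain of the conjugated system by
`obstructionCochain_conj`; ★ F2-B `obstructionCochain_sub_eq_cechMD1`).
[cite: Hartshorne2010, Thm. 10.2 (proof), p. 81] [cite: Hartshorne2010, Cor. 10.3, p. 82] -/
theorem exists_cechMD1_eq_sub_of_conj (h𝔫 : IsNilpotent 𝔫')
    (ψ₁ ψ₂ : (j l : ι) → A' ⊗[k] Γ(X.left, (U j).1 ⊓ (U l).1) ≃ₐ[A'] A' ⊗[k] Γ(X.left, (U j).1 ⊓ (U l).1))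
    (hψ₁ : ∀ j l x, ψ₁ j l x - x ∈ 𝔫' • (⊤ : Submodule A' (A' ⊗[k] Γ(X.left, (U j).1 ⊓ (U l).1))))
    (hψ₂ : ∀ j l x, ψ₂ j l x - x ∈ 𝔫' • (⊤ : Submodule A' (A' ⊗[k] Γ(X.left, (U j).1 ⊓ (U l).1))))
    (F : (j : ι) → A' ⊗[k] Γ(X.left, (U j).1) ≃ₐ[A'] A' ⊗[k] Γ(X.left, (U j).1))
    (hF : ∀ j x, F j x - x ∈ 𝔫' • (⊤ : Submodule A' (A' ⊗[k] Γ(X.left, (U j).1))))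
    (hFψ : ∀ (j l : ι)
      (Φj : A' ⊗[k] Γ(X.left, (U j).1) →ₐ[A'] A' ⊗[k] Γ(X.left, (U j).1 ⊓ (U l).1))
      (_ : ∀ a x, Φj (a ⊗ₜ x) = a ⊗ₜ X.left.presheaf.map (homOfLE inf_le_left).op x)
      (Φl : A' ⊗[k] Γ(X.left, (U l).1) →ₐ[A'] A' ⊗[k] Γ(X.left, (U j).1 ⊓ (U l).1))
      (_ : ∀ a x, Φl (a ⊗ₜ x) = a ⊗ₜ X.left.presheaf.map (homOfLE inf_le_right).op x)
      (Fj Fl : A' ⊗[k] Γ(X.left, (U j).1 ⊓ (U l).1) ≃ₐ[A'] A' ⊗[k] Γ(X.left, (U j).1 ⊓ (U l).1)),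
      (∀ x, Fj (Φj x) = Φj (F j x)) → (∀ x, Fl (Φl x) = Φl (F l x)) →
      ∀ c : Γ(X.left, (U j).1 ⊓ (U l).1),
        Fl (ψ₁ j l ((1 : A') ⊗ₜ c)) - ψ₂ j l (Fj ((1 : A') ⊗ₜ c)) ∈
          J • (⊤ : Submodule A' (A' ⊗[k] Γ(X.left, (U j).1 ⊓ (U l).1))))
    (o₁ o₂ : CechMC2 X.hom (tangentSheaf X) (fun j => (U j).1))
    (ho₁ : ∀ (j l m : ι)
      (Φjl : A' ⊗[k] Γ(X.left, (U j).1 ⊓ (U l).1) →ₐ[A'] A' ⊗[k] Γ(X.left, (U j).1 ⊓ (U l).1 ⊓ (U m).1))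
      (_ : ∀ a s, Φjl (a ⊗ₜ s) = a ⊗ₜ X.left.presheaf.map (homOfLE inf_le_left).op s)
      (Φlm : A' ⊗[k] Γ(X.left, (U l).1 ⊓ (U m).1) →ₐ[A'] A' ⊗[k] Γ(X.left, (U j).1 ⊓ (U l).1 ⊓ (U m).1))
      (_ : ∀ a s, Φlm (a ⊗ₜ s) = a ⊗ₜ X.left.presheaf.map
        (homOfLE (le_inf (inf_le_left.trans inf_le_right) inf_le_right)).op s)
      (Φjm : A' ⊗[k] Γ(X.left, (U j).1 ⊓ (U m).1) →ₐ[A'] A' ⊗[k] Γ(X.left, (U j).1 ⊓ (U l).1 ⊓ (U m).1))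
      (_ : ∀ a s, Φjm (a ⊗ₜ s) = a ⊗ₜ X.left.presheaf.map
        (homOfLE (le_inf (inf_le_left.trans inf_le_left) inf_le_right)).op s)
      (ρjl ρlm ρjm : A' ⊗[k] Γ(X.left, (U j).1 ⊓ (U l).1 ⊓ (U m).1) ≃ₐ[A']
        A' ⊗[k] Γ(X.left, (U j).1 ⊓ (U l).1 ⊓ (U m).1)),
      (∀ x, ρjl (Φjl x) = Φjl (ψ₁ j l x)) → (∀ x, ρlm (Φlm x) = Φlm (ψ₁ l m x)) →
      (∀ x, ρjm (Φjm x) = Φjm (ψ₁ j m x)) →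
      ∀ c : Γ(X.left, (U j).1 ⊓ (U l).1 ⊓ (U m).1), (ρlm * ρjl * ρjm⁻¹) ((1 : A') ⊗ₜ c) =
        (1 : A') ⊗ₜ c + ((e.symm 1 : ↥(J.restrictScalars k)) : A') ⊗ₜ
          (show Γ(X.left, (U j).1 ⊓ (U l).1 ⊓ (U m).1) from appLE (o₁ j l m) (𝟙 _) (dSection X _ c)))
    (ho₂ : ∀ (j l m : ι)
      (Φjl : A' ⊗[k] Γ(X.left, (U j).1 ⊓ (U l).1) →ₐ[A'] A' ⊗[k] Γ(X.left, (U j).1 ⊓ (U l).1 ⊓ (U m).1))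
      (_ : ∀ a s, Φjl (a ⊗ₜ s) = a ⊗ₜ X.left.presheaf.map (homOfLE inf_le_left).op s)
      (Φlm : A' ⊗[k] Γ(X.left, (U l).1 ⊓ (U m).1) →ₐ[A'] A' ⊗[k] Γ(X.left, (U j).1 ⊓ (U l).1 ⊓ (U m).1))
      (_ : ∀ a s, Φlm (a ⊗ₜ s) = a ⊗ₜ X.left.presheaf.map
        (homOfLE (le_inf (inf_le_left.trans inf_le_right) inf_le_right)).op s)
      (Φjm : A' ⊗[k] Γ(X.left, (U j).1 ⊓ (U m).1) →ₐ[A'] A' ⊗[k] Γ(X.left, (U j).1 ⊓ (U l).1 ⊓ (U m).1))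
      (_ : ∀ a s, Φjm (a ⊗ₜ s) = a ⊗ₜ X.left.presheaf.map
        (homOfLE (le_inf (inf_le_left.trans inf_le_left) inf_le_right)).op s)
      (ρjl ρlm ρjm : A' ⊗[k] Γ(X.left, (U j).1 ⊓ (U l).1 ⊓ (U m).1) ≃ₐ[A']
        A' ⊗[k] Γ(X.left, (U j).1 ⊓ (U l).1 ⊓ (U m).1)),
      (∀ x, ρjl (Φjl x) = Φjl (ψ₂ j l x)) → (∀ x, ρlm (Φlm x) = Φlm (ψ₂ l m x)) →
      (∀ x, ρjm (Φjm x) = Φjm (ψ₂ j m x)) →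
      ∀ c : Γ(X.left, (U j).1 ⊓ (U l).1 ⊓ (U m).1), (ρlm * ρjl * ρjm⁻¹) ((1 : A') ⊗ₜ c) =
        (1 : A') ⊗ₜ c + ((e.symm 1 : ↥(J.restrictScalars k)) : A') ⊗ₜ
          (show Γ(X.left, (U j).1 ⊓ (U l).1 ⊓ (U m).1) from appLE (o₂ j l m) (𝟙 _) (dSection X _ c))) :
    ∃ α : CechMC1 X.hom (tangentSheaf X) (fun j => (U j).1),
      o₂ - o₁ = cechMD1 X.hom (tangentSheaf X) (fun j => (U j).1) α := by
  -- restrictions of the chart automorphisms to the pairwise overlaps (★ F1/F2)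
  have hUlj : ∀ j l, (U j).1 ⊓ (U l).1 = X.left.basicOpen (b l j) := fun j l => by
    rw [inf_comm]
    exact hb l j
  have hΦR := fun j l => exists_baseChangeMap (A' := A') halg (U j).1 ((U j).1 ⊓ (U l).1) inf_le_left
  choose ΦR hΦR using hΦR
  have hΦL := fun j l => exists_baseChangeMap (A' := A') halg (U l).1 ((U j).1 ⊓ (U l).1) inf_le_right
  choose ΦL hΦL using hΦL
  have hexR := fun j l => exists_algEquiv_restrict halg 𝔫' (U j).2 (b j l) (hb j l) inf_le_left h𝔫 (F j) (hF j)
    (hΦR j l)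
  choose FR hFR hFR𝔫 using hexR
  have hexL := fun j l => exists_algEquiv_restrict halg 𝔫' (U l).2 (b l j) (hUlj j l) inf_le_right h𝔫 (F l) (hF l)
    (hΦL j l)
  choose FL hFL hFL𝔫 using hexL
  have hFR' : ∀ (j l : ι) (Φ : A' ⊗[k] Γ(X.left, (U j).1) →ₐ[A'] A' ⊗[k] Γ(X.left, (U j).1 ⊓ (U l).1)),
      (∀ a x, Φ (a ⊗ₜ x) = a ⊗ₜ X.left.presheaf.map (homOfLE inf_le_left).op x) →
      ∀ x, FR j l (Φ x) = Φ (F j x) := fun j l Φ hΦ => by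
    have eΦ : Φ = ΦR j l := Algebra.TensorProduct.ext' fun a x => by rw [hΦ, hΦR]
    subst eΦ
    exact hFR j l
  have hFL' : ∀ (j l : ι) (Φ : A' ⊗[k] Γ(X.left, (U l).1) →ₐ[A'] A' ⊗[k] Γ(X.left, (U j).1 ⊓ (U l).1)),
      (∀ a x, Φ (a ⊗ₜ x) = a ⊗ₜ X.left.presheaf.map (homOfLE inf_le_right).op x) →
      ∀ x, FL j l (Φ x) = Φ (F l x) := fun j l Φ hΦ => by
    have eΦ : Φ = ΦL j l := Algebra.TensorProduct.ext' fun a x => by rw [hΦ, hΦL]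
    subst eΦ
    exact hFL j l
  -- the conjugated system `ψ₁^F j l = F_l| ψ₁ j l F_j|⁻¹`, again `≡ 1 (mod 𝔫')`
  have hψ₁' : ∀ j l x, (FL j l * ψ₁ j l * (FR j l)⁻¹) x - x ∈
      𝔫' • (⊤ : Submodule A' (A' ⊗[k] Γ(X.left, (U j).1 ⊓ (U l).1))) := fun j l =>
    mul_apply_sub_self_mem_smul_top 𝔫' (mul_apply_sub_self_mem_smul_top 𝔫' (hFL𝔫 j l) (hψ₁ j l))
      (inv_apply_sub_self_mem_smul_top 𝔫' (hFR𝔫 j l))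
  -- `ψ₂ (ψ₁^F)⁻¹ ≡ 1 (mod J)` by the intertwining hypothesis, extended `A'`-linearly
  have hFψ' : ∀ j l x, FL j l (ψ₁ j l x) - ψ₂ j l (FR j l x) ∈
      J • (⊤ : Submodule A' (A' ⊗[k] Γ(X.left, (U j).1 ⊓ (U l).1))) := fun j l x => by
    have h := sub_mem_smul_top_of_forall_one_tmul J ((FL j l).toLinearMap ∘ₗ (ψ₁ j l).toLinearMap)
      ((ψ₂ j l).toLinearMap ∘ₗ (FR j l).toLinearMap) (fun c => by
        simpa only [LinearMap.comp_apply, AlgEquiv.toLinearMap_apply] using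
          hFψ j l (ΦR j l) (hΦR j l) (ΦL j l) (hΦL j l) (FR j l) (FL j l) (hFR j l) (hFL j l) c) x
    simpa only [LinearMap.comp_apply, AlgEquiv.toLinearMap_apply] using h
  have hJ' : ∀ j l y, (ψ₂ j l * (FL j l * ψ₁ j l * (FR j l)⁻¹)⁻¹) y - y ∈
      J • (⊤ : Submodule A' (A' ⊗[k] Γ(X.left, (U j).1 ⊓ (U l).1))) := fun j l y => by
    obtain ⟨w, rfl⟩ := (FL j l * ψ₁ j l * (FR j l)⁻¹).surjective y
    obtain ⟨x, rfl⟩ := (FR j l).surjective w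
    rw [AlgEquiv.mul_apply, AlgEquiv.aut_inv (FL j l * ψ₁ j l * (FR j l)⁻¹), AlgEquiv.symm_apply_apply,
      AlgEquiv.mul_apply, AlgEquiv.mul_apply, AlgEquiv.aut_inv, AlgEquiv.symm_apply_apply, ← neg_sub]
    exact Submodule.neg_mem _ (hFψ' j l x)
  -- `α j l` represents it
  have hα := fun j l => exists_tangentSheaf_section_rep halg J hJ e (isAffineOpen_inf₂ U b hb j l)
    (ψ₂ j l * (FL j l * ψ₁ j l * (FR j l)⁻¹)⁻¹) (hJ' j l)
  choose α hα using hα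
  -- ★ F2-B change of lifts, with `o₁` an obstruction cochain of the conjugated system (§2)
  exact ⟨α, obstructionCochain_sub_eq_cechMD1 halg J 𝔫' hJ hJ𝔫 e U b hb h𝔫 (fun j l => FL j l * ψ₁ j l * (FR j l)⁻¹) ψ₂
    hψ₁' hψ₂ α hα o₁ o₂ (obstructionCochain_conj halg U b hb J 𝔫' hJ hJ𝔫 e h𝔫 ψ₁ F FR FL hFR' hFL' hFR𝔫 hFL𝔫 o₁ ho₁)
    ho₂⟩

include halg hb hJ hJ𝔫 in
/-- **Corollary: the obstruction cochains of intertwined lift systems on one cover differ by a Čech `2`-coboundary**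
(`o₂ − o₁ ∈ B̌²(𝔘, 𝒯_{X/k})`) — the same-cover half of the cover independence of the obstruction class.
[cite: Hartshorne2010, Thm. 10.2 (proof), p. 81] [cite: Hartshorne2010, Cor. 10.3, p. 82] -/
theorem obstructionCochain_sub_mem_cechMB2_of_conj (h𝔫 : IsNilpotent 𝔫')
    (ψ₁ ψ₂ : (j l : ι) → A' ⊗[k] Γ(X.left, (U j).1 ⊓ (U l).1) ≃ₐ[A'] A' ⊗[k] Γ(X.left, (U j).1 ⊓ (U l).1))
    (hψ₁ : ∀ j l x, ψ₁ j l x - x ∈ 𝔫' • (⊤ : Submodule A' (A' ⊗[k] Γ(X.left, (U j).1 ⊓ (U l).1))))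
    (hψ₂ : ∀ j l x, ψ₂ j l x - x ∈ 𝔫' • (⊤ : Submodule A' (A' ⊗[k] Γ(X.left, (U j).1 ⊓ (U l).1))))
    (F : (j : ι) → A' ⊗[k] Γ(X.left, (U j).1) ≃ₐ[A'] A' ⊗[k] Γ(X.left, (U j).1))
    (hF : ∀ j x, F j x - x ∈ 𝔫' • (⊤ : Submodule A' (A' ⊗[k] Γ(X.left, (U j).1))))
    (hFψ : ∀ (j l : ι)
      (Φj : A' ⊗[k] Γ(X.left, (U j).1) →ₐ[A'] A' ⊗[k] Γ(X.left, (U j).1 ⊓ (U l).1))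
      (_ : ∀ a x, Φj (a ⊗ₜ x) = a ⊗ₜ X.left.presheaf.map (homOfLE inf_le_left).op x)
      (Φl : A' ⊗[k] Γ(X.left, (U l).1) →ₐ[A'] A' ⊗[k] Γ(X.left, (U j).1 ⊓ (U l).1))
      (_ : ∀ a x, Φl (a ⊗ₜ x) = a ⊗ₜ X.left.presheaf.map (homOfLE inf_le_right).op x)
      (Fj Fl : A' ⊗[k] Γ(X.left, (U j).1 ⊓ (U l).1) ≃ₐ[A'] A' ⊗[k] Γ(X.left, (U j).1 ⊓ (U l).1)),
      (∀ x, Fj (Φj x) = Φj (F j x)) → (∀ x, Fl (Φl x) = Φl (F l x)) →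
      ∀ c : Γ(X.left, (U j).1 ⊓ (U l).1),
        Fl (ψ₁ j l ((1 : A') ⊗ₜ c)) - ψ₂ j l (Fj ((1 : A') ⊗ₜ c)) ∈
          J • (⊤ : Submodule A' (A' ⊗[k] Γ(X.left, (U j).1 ⊓ (U l).1))))
    (o₁ o₂ : CechMC2 X.hom (tangentSheaf X) (fun j => (U j).1))
    (ho₁ : ∀ (j l m : ι)
      (Φjl : A' ⊗[k] Γ(X.left, (U j).1 ⊓ (U l).1) →ₐ[A'] A' ⊗[k] Γ(X.left, (U j).1 ⊓ (U l).1 ⊓ (U m).1))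
      (_ : ∀ a s, Φjl (a ⊗ₜ s) = a ⊗ₜ X.left.presheaf.map (homOfLE inf_le_left).op s)
      (Φlm : A' ⊗[k] Γ(X.left, (U l).1 ⊓ (U m).1) →ₐ[A'] A' ⊗[k] Γ(X.left, (U j).1 ⊓ (U l).1 ⊓ (U m).1))
      (_ : ∀ a s, Φlm (a ⊗ₜ s) = a ⊗ₜ X.left.presheaf.map
        (homOfLE (le_inf (inf_le_left.trans inf_le_right) inf_le_right)).op s)
      (Φjm : A' ⊗[k] Γ(X.left, (U j).1 ⊓ (U m).1) →ₐ[A'] A' ⊗[k] Γ(X.left, (U j).1 ⊓ (U l).1 ⊓ (U m).1))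
      (_ : ∀ a s, Φjm (a ⊗ₜ s) = a ⊗ₜ X.left.presheaf.map
        (homOfLE (le_inf (inf_le_left.trans inf_le_left) inf_le_right)).op s)
      (ρjl ρlm ρjm : A' ⊗[k] Γ(X.left, (U j).1 ⊓ (U l).1 ⊓ (U m).1) ≃ₐ[A']
        A' ⊗[k] Γ(X.left, (U j).1 ⊓ (U l).1 ⊓ (U m).1)),
      (∀ x, ρjl (Φjl x) = Φjl (ψ₁ j l x)) → (∀ x, ρlm (Φlm x) = Φlm (ψ₁ l m x)) →
      (∀ x, ρjm (Φjm x) = Φjm (ψ₁ j m x)) →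
      ∀ c : Γ(X.left, (U j).1 ⊓ (U l).1 ⊓ (U m).1), (ρlm * ρjl * ρjm⁻¹) ((1 : A') ⊗ₜ c) =
        (1 : A') ⊗ₜ c + ((e.symm 1 : ↥(J.restrictScalars k)) : A') ⊗ₜ
          (show Γ(X.left, (U j).1 ⊓ (U l).1 ⊓ (U m).1) from appLE (o₁ j l m) (𝟙 _) (dSection X _ c)))
    (ho₂ : ∀ (j l m : ι)
      (Φjl : A' ⊗[k] Γ(X.left, (U j).1 ⊓ (U l).1) →ₐ[A'] A' ⊗[k] Γ(X.left, (U j).1 ⊓ (U l).1 ⊓ (U m).1))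
      (_ : ∀ a s, Φjl (a ⊗ₜ s) = a ⊗ₜ X.left.presheaf.map (homOfLE inf_le_left).op s)
      (Φlm : A' ⊗[k] Γ(X.left, (U l).1 ⊓ (U m).1) →ₐ[A'] A' ⊗[k] Γ(X.left, (U j).1 ⊓ (U l).1 ⊓ (U m).1))
      (_ : ∀ a s, Φlm (a ⊗ₜ s) = a ⊗ₜ X.left.presheaf.map
        (homOfLE (le_inf (inf_le_left.trans inf_le_right) inf_le_right)).op s)
      (Φjm : A' ⊗[k] Γ(X.left, (U j).1 ⊓ (U m).1) →ₐ[A'] A' ⊗[k] Γ(X.left, (U j).1 ⊓ (U l).1 ⊓ (U m).1))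
      (_ : ∀ a s, Φjm (a ⊗ₜ s) = a ⊗ₜ X.left.presheaf.map
        (homOfLE (le_inf (inf_le_left.trans inf_le_left) inf_le_right)).op s)
      (ρjl ρlm ρjm : A' ⊗[k] Γ(X.left, (U j).1 ⊓ (U l).1 ⊓ (U m).1) ≃ₐ[A']
        A' ⊗[k] Γ(X.left, (U j).1 ⊓ (U l).1 ⊓ (U m).1)),
      (∀ x, ρjl (Φjl x) = Φjl (ψ₂ j l x)) → (∀ x, ρlm (Φlm x) = Φlm (ψ₂ l m x)) →
      (∀ x, ρjm (Φjm x) = Φjm (ψ₂ j m x)) →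
      ∀ c : Γ(X.left, (U j).1 ⊓ (U l).1 ⊓ (U m).1), (ρlm * ρjl * ρjm⁻¹) ((1 : A') ⊗ₜ c) =
        (1 : A') ⊗ₜ c + ((e.symm 1 : ↥(J.restrictScalars k)) : A') ⊗ₜ
          (show Γ(X.left, (U j).1 ⊓ (U l).1 ⊓ (U m).1) from appLE (o₂ j l m) (𝟙 _) (dSection X _ c))) :
    o₂ - o₁ ∈ cechMB2 X.hom (tangentSheaf X) (fun j => (U j).1) := by
  obtain ⟨α, hα⟩ := exists_cechMD1_eq_sub_of_conj halg U b hb J 𝔫' hJ hJ𝔫 e h𝔫 ψ₁ ψ₂ hψ₁ hψ₂ F hF hFψ o₁ o₂ ho₁ ho₂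
  exact (mem_cechMB2_iff X.hom (tangentSheaf X) _ _).2 ⟨α, hα.symm⟩

end SameCover

end Literature.AlgebraicGeometry.Deformation

end
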